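import Summits.Ventures.QEC.CircuitDistance.PortKindColumns
import HarnessLib

/-!
# P3-PORT (E2): `ℤ_ℓ × ℤ_m` EQUIVARIANCE of the simulation (cell `qec`, experiment CDX, seat qec-cdx-type-1)

The SM circuit is translation-invariant (`CNOT_M` couples position `i` to `i + μ`), so translating a fault by
`t ∈ ℤ_ℓ × ℤ_m` translates its whole effect: `Fault.translate`, `State.translate`, `applyEv_translate`, `inject_translate`,
**`run1_translate`**, `shape_translate`, and the column forms `detZ_translate_singleton`, `detX_translate_singleton`,
`dataX_translate_singleton`, `dataZ_translate_singleton`.  Generic in `S`; nothing here asserts a value of `d_circ`.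
-/

namespace Summit.Ventures.QEC.CircuitDistance

open Literature.InformationTheory.QuantumCodes

variable {ℓ m : ℕ}

/-- Translate a fault's base index by `t`. -/
def Fault.translate (t : BB.Mono ℓ m) : Fault ℓ m → Fault ℓ m
  | .cnot c lay i pc pt => .cnot c lay (i + t) pc pt
  | .idle c s i p => .idle c s (i + t) p
  | .initX c i => .initX c (i + t)
  | .initZ c i => .initZ c (i + t)
  | .measX c i => .measX c (i + t)
  | .measZ c i => .measZ c (i + t)

/-- Translate a state: frame and outcome flips move with the qubits. -/
def State.translate (t : BB.Mono ℓ m) (st : State ℓ m) : State ℓ m :=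
  ⟨fun q => st.frame (q.1, q.2 - t), fun c i => st.mX c (i - t), fun c j => st.mZ c (j - t)⟩

/-- Translation keeps the event. -/
@[simp] theorem Fault.ev_translate (t : BB.Mono ℓ m) (f : Fault ℓ m) : (f.translate t).ev = f.ev := by cases f <;> rfl

/-- Translation keeps the cycle. -/
@[simp] theorem Fault.cyc_translate (t : BB.Mono ℓ m) (f : Fault ℓ m) : (f.translate t).cyc = f.cyc := by cases f <;> rfl

/-- Translation keeps the `X`-kind and translates the base index. -/
theorem Fault.xKind_translate (t : BB.Mono ℓ m) (f : Fault ℓ m) :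
    (f.translate t).xKind = f.xKind.map fun ki => (ki.1, ki.2 + t) := by
  cases f <;> simp [Fault.translate, Fault.xKind]

/-- Translation keeps the `Z`-kind and translates the base index. -/
theorem Fault.zKind_translate (t : BB.Mono ℓ m) (f : Fault ℓ m) :
    (f.translate t).zKind = f.zKind.map fun ki => (ki.1, ki.2 + t) := by
  cases f <;> simp [Fault.translate, Fault.zKind]

/-- A representative at cycle `c` is the retag of the representative at cycle `1`. -/
theorem XKind.fault_eq_retag (k : XKind) (c : ℕ) (i : BB.Mono ℓ m) :
    (k.fault c i : Fault ℓ m) = (k.fault 1 i).retag c := by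
  cases k <;> rfl

/-- A representative at cycle `c` is the retag of the representative at cycle `1`. -/
theorem ZKind.fault_eq_retag (k : ZKind) (c : ℕ) (i : BB.Mono ℓ m) :
    (k.fault c i : Fault ℓ m) = (k.fault 1 i).retag c := by
  cases k <;> rfl

/-- The all-clear state is translation-invariant. -/
@[simp] theorem State.init_translate (t : BB.Mono ℓ m) : (State.init : State ℓ m).translate t = State.init := rfl

variable [NeZero ℓ] [NeZero m]

/-- A representative at base index `i` is the translate of the representative at base index `0`. -/
theorem XKind.fault_eq_translate (k : XKind) (c : ℕ) (i : BB.Mono ℓ m) :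
    (k.fault c i : Fault ℓ m) = (k.fault c 0).translate i := by
  cases k <;> simp [XKind.fault, Fault.translate]

/-- A representative at base index `i` is the translate of the representative at base index `0`. -/
theorem ZKind.fault_eq_translate (k : ZKind) (c : ℕ) (i : BB.Mono ℓ m) :
    (k.fault c i : Fault ℓ m) = (k.fault c 0).translate i := by
  cases k <;> simp [ZKind.fault, Fault.translate]

/-- Ideal operations commute with translation. -/
theorem applyEv_translate (S : SMCode ℓ m) (e : Ev) (t : BB.Mono ℓ m) (st : State ℓ m) :
    applyEv S e (st.translate t) = (applyEv S e st).translate t := by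
  have e1 : ∀ (x μ : BB.Mono ℓ m), x - μ - t = x - t - μ := fun x μ => sub_right_comm x μ t
  have e2 : ∀ (x μ : BB.Mono ℓ m), x + μ - t = x - t + μ := fun x μ => add_sub_right_comm x μ t
  cases e with
  | cnot c lay =>
    refine State.ext' ?_ rfl rfl
    funext q
    simp only [applyEv, State.translate, Frame.cnotLayer, e1, e2]
  | measX c => refine State.ext' rfl ?_ rfl; funext c' i; simp only [applyEv, State.translate]
  | measZ c => refine State.ext' rfl rfl ?_; funext c' j; simp only [applyEv, State.translate]
  | initX c => refine State.ext' ?_ rfl rfl; funext q; simp only [applyEv, State.translate, Frame.clearReg]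
  | initZ c => refine State.ext' ?_ rfl rfl; funext q; simp only [applyEv, State.translate, Frame.clearReg]
  | idle c s => rfl

/-- A point equation on the torus: `q = (r, i + t) ↔ (q.1, q.2 - t) = (r, i)`. -/
theorem qubit_eq_translate_iff (q : Qubit ℓ m) (r : Reg) (i t : BB.Mono ℓ m) :
    (q = (r, i + t)) ↔ ((q.1, q.2 - t) = (r, i)) := by
  rcases q with ⟨r', x⟩
  simp only [Prod.mk.injEq, sub_eq_iff_eq_add]

/-- Multiplying a Pauli in commutes with translation. -/
theorem mulAt_translate (F : Frame ℓ m) (r : Reg) (i t : BB.Mono ℓ m) (p : P1) (q : Qubit ℓ m) :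
    (Frame.mulAt (fun q => F (q.1, q.2 - t)) (r, i + t) p) q = (F.mulAt (r, i) p) (q.1, q.2 - t) := by
  simp only [Frame.mulAt]
  by_cases h : q = (r, i + t)
  · rw [if_pos h, if_pos ((qubit_eq_translate_iff q r i t).1 h)]
  · rw [if_neg h, if_neg (fun h' => h ((qubit_eq_translate_iff q r i t).2 h'))]

/-- Injections commute with translation. -/
theorem inject_translate (S : SMCode ℓ m) (f : Fault ℓ m) (t : BB.Mono ℓ m) (st : State ℓ m) :
    inject S (f.translate t) (st.translate t) = (inject S f st).translate t := by
  cases f with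
  | cnot c lay i pc pt =>
    refine State.ext' ?_ rfl rfl
    funext q
    show ((Frame.mulAt (fun q => st.frame (q.1, q.2 - t)) (lay.ctrl, i + t) pc).mulAt (lay.tgt, i + t + lay.mon S) pt) q =
      ((st.frame.mulAt (lay.ctrl, i) pc).mulAt (lay.tgt, i + lay.mon S) pt) (q.1, q.2 - t)
    rw [show i + t + lay.mon S = i + lay.mon S + t from add_right_comm i t (lay.mon S)]
    have h1 := mulAt_translate (st.frame.mulAt (lay.ctrl, i) pc) lay.tgt (i + lay.mon S) t pt q
    rw [← h1]
    congr 1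
    funext q'
    exact mulAt_translate st.frame lay.ctrl i t pc q'
  | idle c s i p =>
    refine State.ext' ?_ rfl rfl
    funext q
    exact mulAt_translate st.frame s.reg i t p q
  | initX c i =>
    refine State.ext' ?_ rfl rfl
    funext q
    exact mulAt_translate st.frame Reg.X i t (false, true) q
  | initZ c i =>
    refine State.ext' ?_ rfl rfl
    funext q
    exact mulAt_translate st.frame Reg.Z i t (true, false) q
  | measX c i =>
    refine State.ext' rfl ?_ rfl
    funext c' i'
    simp only [inject, Fault.translate, State.translate, sub_eq_iff_eq_add]
  | measZ c i =>
    refine State.ext' rfl rfl ?_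
    funext c' i'
    simp only [inject, Fault.translate, State.translate, sub_eq_iff_eq_add]

/-- The simulation commutes with translation. -/
theorem simulate_translate (S : SMCode ℓ m) (f : Fault ℓ m) (t : BB.Mono ℓ m) (es : List Ev) (st : State ℓ m) :
    simulate S (f.translate t) es (st.translate t) = (simulate S f es st).translate t := by
  induction es generalizing st with
  | nil => rfl
  | cons e es ih =>
    rw [simulate_cons, simulate_cons, Fault.ev_translate, applyEv_translate]
    by_cases he : e = f.ev
    · rw [if_pos he, if_pos he, inject_translate, ih]
    · rw [if_neg he, if_neg he, ih]

/-- **EQUIVARIANCE of `run1`.** The effect of a translated fault is the translated effect. -/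
theorem run1_translate (S : SMCode ℓ m) (Nc : ℕ) (f : Fault ℓ m) (t : BB.Mono ℓ m) :
    run1 S Nc (f.translate t) = (run1 S Nc f).translate t := by
  unfold run1; rw [← simulate_translate, State.init_translate]

/-- Shapes are translation-equivariant. -/
theorem shape_translate (S : SMCode ℓ m) (f : Fault ℓ m) (t : BB.Mono ℓ m) :
    shape S (f.translate t) = (shape S f).translate t := by
  unfold shape; rw [Fault.cyc_translate, ← simulate_translate, State.init_translate]

/-- `H^Z` applied to a translated vector. -/
theorem HZ_mulVec_translate (S : SMCode ℓ m) (v : BB.Mono ℓ m ⊕ BB.Mono ℓ m → ZMod 2) (t j : BB.Mono ℓ m) :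
    (S.toCode.HZ.mulVec fun q => v ((BB.Code.translate t).symm q)) j = (S.toCode.HZ.mulVec v) (j - t) := by
  simp only [Matrix.mulVec, dotProduct]
  rw [← Equiv.sum_comp (BB.Code.translate t)]
  apply Finset.sum_congr rfl
  intro q _
  rw [Equiv.symm_apply_apply]
  congr 1
  have := BB.Code.HZ_translate S.toCode t (j - t) q
  rw [sub_add_cancel] at this
  exact this

/-- `H^X` applied to a translated vector. -/
theorem HX_mulVec_translate (S : SMCode ℓ m) (v : BB.Mono ℓ m ⊕ BB.Mono ℓ m → ZMod 2) (t i : BB.Mono ℓ m) :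
    (S.toCode.HX.mulVec fun q => v ((BB.Code.translate t).symm q)) i = (S.toCode.HX.mulVec v) (i - t) := by
  simp only [Matrix.mulVec, dotProduct]
  rw [← Equiv.sum_comp (BB.Code.translate t)]
  apply Finset.sum_congr rfl
  intro q _
  rw [Equiv.symm_apply_apply]
  congr 1
  have := BB.Code.HX_translate S.toCode t (i - t) q
  rw [sub_add_cancel] at this
  exact this

/-- The inverse translation on the column index in terms of register positions. -/
theorem translate_symm_elim (t : BB.Mono ℓ m) (q : BB.Mono ℓ m ⊕ BB.Mono ℓ m) :
    (Sum.elim (fun i => (Reg.L, i)) (fun i => (Reg.R, i)) ((BB.Code.translate t).symm q) : Qubit ℓ m) =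
      ((Sum.elim (fun i => (Reg.L, i)) (fun i => (Reg.R, i)) q).1, (Sum.elim (fun i => (Reg.L, i)) (fun i => (Reg.R, i)) q).2 - t) := by
  rcases q with i | i <;> simp [BB.Code.translate, sub_eq_add_neg]

/-- Data `x`-bits of a translated state. -/
theorem dataXb_translate (st : State ℓ m) (t : BB.Mono ℓ m) (q : BB.Mono ℓ m ⊕ BB.Mono ℓ m) :
    (st.translate t).frame.dataXb q = st.frame.dataXb ((BB.Code.translate t).symm q) := by
  unfold Frame.dataXb State.translate; dsimp only; rw [translate_symm_elim]

/-- Data `z`-bits of a translated state. -/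
theorem dataZb_translate (st : State ℓ m) (t : BB.Mono ℓ m) (q : BB.Mono ℓ m ⊕ BB.Mono ℓ m) :
    (st.translate t).frame.dataZb q = st.frame.dataZb ((BB.Code.translate t).symm q) := by
  unfold Frame.dataZb State.translate; dsimp only; rw [translate_symm_elim]

/-- Residual `X`-error of a translated fault. -/
theorem dataX_translate_singleton (S : SMCode ℓ m) (Nc : ℕ) (f : Fault ℓ m) (t : BB.Mono ℓ m) :
    dataX S Nc {f.translate t} = fun q => dataX S Nc {f} ((BB.Code.translate t).symm q) := by
  rw [dataX_singleton_run1, dataX_singleton_run1, run1_translate]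
  funext q
  simp only [toZ2, dataXb_translate]

/-- Residual `Z`-error of a translated fault. -/
theorem dataZ_translate_singleton (S : SMCode ℓ m) (Nc : ℕ) (f : Fault ℓ m) (t : BB.Mono ℓ m) :
    dataZ S Nc {f.translate t} = fun q => dataZ S Nc {f} ((BB.Code.translate t).symm q) := by
  rw [dataZ_singleton_run1, dataZ_singleton_run1, run1_translate]
  funext q
  simp only [toZ2, dataZb_translate]

/-- `Z`-detectors of a translated fault. -/
theorem detZ_translate_singleton (S : SMCode ℓ m) (Nc : ℕ) (f : Fault ℓ m) (t : BB.Mono ℓ m) (s : ℕ) (j : BB.Mono ℓ m) :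
    detZ S Nc {f.translate t} s j = detZ S Nc {f} s (j - t) := by
  unfold detZ
  simp only [flipZ_singleton, run1_translate, dataX_translate_singleton, HZ_mulVec_translate]
  rfl

/-- `X`-detectors of a translated fault. -/
theorem detX_translate_singleton (S : SMCode ℓ m) (Nc : ℕ) (f : Fault ℓ m) (t : BB.Mono ℓ m) (s : ℕ) (i : BB.Mono ℓ m) :
    detX S Nc {f.translate t} s i = detX S Nc {f} s (i - t) := by
  unfold detX
  simp only [flipX_singleton, run1_translate, dataZ_translate_singleton, HX_mulVec_translate]
  rfl

end Summit.Ventures.QEC.CircuitDistance
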